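import Literature.NumberTheory.LFunctions.SchoenfeldZeroSums
import Mathlib.MeasureTheory.Integral.IntervalIntegral.IntegrationByParts
import HarnessLib

/-!
# RH-FREE — Explicit sums over the zeros of `ζ`: Lehman's lemma (proved) and the Brent–Platt–Trudgian bounds `|N(T) − L(T)| ≤ 0.28 log T`, `Σ_{γ>T} 1/γ²`, `Σ_{γ≤T} 1/γ`, `Σ 1/γ² = 0.0231049…` («nothing here bears on the truth of RH»)

Topic `Literature/NumberTheory/LFunctions` (RH literature-typing tranche 1, L4 "explicit zero
statistics", gen 2: explicit SUMS over zeros, the currency of Li-window / Weil-handoff budgets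
and of explicit `ψ`-bounds). Label: **RH-FREE** — unconditional published results about the
ordinates `γ` of the non-trivial zeros (nothing about their real parts), vendored as NAMED FACTS
(`def … : Prop`, D-0014; nothing asserted, users take `(h : …)`), and Lehman's lemma PROVED from
the tree's partial summation against `N(t)`. Nothing here bears on the truth of RH.

Vocabulary (all from the tree, `SchoenfeldZeroSums.lean`, namespace
`Literature.NumberTheory.LFunctions.SchoenfeldBound`): `N(T) = zetaZeroCount T` (zeros with
`0 < γ ≤ T`, multiplicity); Backlund's main term `L(T) = countMain T = (T/2π) log(T/2π) − T/2π + 7/8`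
(BPT's `L(T)`; so BPT's `Q(T) = N(T) − L(T)` is `zetaZeroCount T − countMain T`); the zeros with
`T₁ < γ ≤ T₂` as the finite set `zerosBetween T₁ T₂` with weights `m(ρ) = riemannZetaZeroOrder ρ`;
`S(T) = zetaArgS T` and `θ = riemannSiegelTheta` (`RiemannSiegel.lean`).

## Sources and what is typed

* **Brent–Platt–Trudgian 2022**, J. Number Theory 238 (2022) 740–762 (arXiv:2008.06140), §2
  "Preliminary results" ("The results in this section are unconditional")
  `[corpus:paper:arxiv-2008.06140 p0004–p0005]`:
  - `BrentPlattTrudgian2022_lemma1` — **Lemma 1** (Backlund–Platt–Trudgian): for `T ≥ 2πe`,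
    `|N(T) − L(T)| ≤ 0.11 log T + 0.29 log log T + 2.29 + 0.2/T` (Platt–Trudgian 2015, Cor. 1;
    its input `|ζ(½+it)| ≤ 0.732 t^{1/6} log t` used the Cheng–Graham Kusmin–Landau constant, but
    the inequality holds by Hiary–Patel–Yang's `0.618`, `ZetaHalfLineHiaryPatelYang.lean`);
  - `BrentPlattTrudgian2022_cor1` — **Corollary 1**: for all `T ≥ 2π`, `|N(T) − L(T)| ≤ 0.28 log T`
    (Lemma 1 for `T ≥ 1.03·10⁸`, an interval-arithmetic verification against the zeros below);
  - **Lemma 2** (Lehman-decreasing: "If `2πe ≤ T₁ ≤ T₂` and `φ` is monotone non-increasing on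
    `[T₁,T₂]`, then `Σ_{T₁<γ≤T₂} φ(γ) = (1/2π)∫_{T₁}^{T₂} φ(t) log(t/2π) dt + Aϑ(2φ(T₁) log T₁ + ∫_{T₁}^{T₂} φ(t)/t dt)`",
    `A` any constant with `|N(T) − L(T)| ≤ A log T` for `T ≥ 2π`) is PROVED here for `φ ∈ C¹`
    (`lehman_sum_le`, `lehman_le_sum`, `abs_lehman`), for every `T₁ ≥ 2π` — Lehman's own partial
    summation (Lehman 1966, Lemma), on top of the tree's `SchoenfeldBound.sum_zerosBetween_eq`
    `-- TODO(general form): merely monotone φ (Stieltjes form), not needed by any user`;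
  - **Lemma 5** (`Σ_{γ>T} 1/γ² ≤ log T/(2πT)`, `T ≥ 2πe`) is PROVED from Corollary 1 in the
    finite-truncation form `Σ_{T<γ≤U} m(ρ)/γ² ≤ …` for every `U ≥ T` (equivalent to the printed
    tail bound, the terms being non-negative): `BrentPlattTrudgian2022_cor1.sum_inv_sq_le`, via
    the `A`-explicit intermediate `sum_inv_sq_le_of_count` (`(L + 1 − log 2π)/(2πT) + A(4L+1)/(2T²)`,
    the source's displayed line);
  - `BrentPlattTrudgian2022_lemma8` — **Lemma 8**: for `T ≥ 4πe`, `Σ_{0<γ≤T} 1/γ ≤ log²(T/2π)/(4π)`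
    (needs the first 80 zeros; named fact).
* **Brent–Platt–Trudgian 2021**, Math. Comp. 90 (2021) 2923–2935 (arXiv:2009.13791)
  `[corpus:paper:arxiv-2009.13791 p0004 (Lemma 2), p0006 (Cor. 1)]`:
  - `BrentPlattTrudgian2021_lemma2` — **Lemma 2**: for `t ≥ 2π`, `|Q(t) − S(t)| ≤ 1/(150t)`; with
    the tree's DEFINITION `S(T) := N(T) − θ(T)/π − 1` this is the statement
    `|θ(t)/π + 1 − L(t)| ≤ 1/(150t)` about the Riemann–Siegel theta function (the source proves it
    exactly so, from Brent's bound for Stirling's series; the tree's proved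
    `abs_zetaZeroCount_sub_main_sub_zetaArgS_le` gives `1.2/(πt)`);
  - `BrentPlattTrudgian2021_eq29` — the standing **condition (2.9)** extended to `[2π, ∞)`:
    `|S₁(T) − S₁(168π)| = |∫_{168π}^T S| ≤ 2.067 + 0.059 log T` for `T ≥ 2π` (Trudgian 2011, Thm. 2.2
    for `T > 168π` — a tree theorem, `abs_integral_zetaArgS_le_trudgian_holds` — plus BPT's "small
    computation" on `[2π, 168π]`; the hypothesis of their refined Lehman lemma, Lemma 3 / Thms 1–3);
  - `BrentPlattTrudgian2021_cor1` — **Corollary 1**: `Σ_{γ>0} 1/γ² = 0.0231049931154189707889338104 + ϑ(5·10⁻²⁸)`,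
    typed as the two-sided bound on every finite truncation from below and on the supremum
    (`∀ U, Σ_{0<γ≤U} ≤ c₁⁺` and `∀ ε>0 ∃ U, Σ_{0<γ≤U} ≥ c₁⁻ − ε`).
* **Brent–Platt–Trudgian 2021 (Bull. Aust. Math. Soc. 104, 59–65)**, Theorem 1 ("The limit `H`
  exists") with Corollary 1 (`H = −0.0171594043070981495 + ϑ(10⁻¹⁸)`), where
  `H = lim_{T→∞} (Σ_{0<γ≤T} 1/γ − log²(T/2π)/(4π))` `[corpus:paper:arxiv-2009.05251 p0004, p0006]`
  — `BrentPlattTrudgian2021BAMS_thm1` (existence of the limit and its value).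

## Conventions (equivalence with print)

BPT 2021 take `N`, `S` averaged at ordinates; the tree's are right-continuous. Lemma 2 concerns
`Q − S = θ/π + 1 − L`, continuous, identical in both conventions. Corollary 1 of BPT 2022
("for all `T ≥ 2π`") for the right-continuous `N` is equivalent to the averaged one (one-sided
limits of `N`, continuity of `0.28 log T`). Sums "`Σ_{T₁<γ≤T₂}`" (BPT 2022, no primes) are
exactly `Σ_{ρ ∈ zerosBetween T₁ T₂} m(ρ) φ(Im ρ)`; ordinates are counted with multiplicity
(source: "weighted by their multiplicities").

## Proved here (no new hypotheses)

`hasDerivAt_countMain` (`L'(t) = log(t/2π)/(2π)`), `lehman_identity`, `lehman_sum_le`,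
`lehman_le_sum`, `abs_lehman` (Lehman's lemma, `C¹` form, any `A`), `sum_inv_sq_le_of_count` (the
`A`-explicit tail bound), `abs_sum_inv_sub_le_of_count` (the harmonic sum between two heights,
`|Σ_{T₁<γ≤T} m/γ − (log²(T/2π) − log²(T₁/2π))/(4π)| ≤ A(2 log T₁ + 1)/T₁`, the first display of
the proof of Lemma 8), `countMain_sub_le` and `zetaZeroCount_window_le_of_count` (explicit local
count `N(T+h) − N(T) ≤ h log((T+h)/2π)/(2π) + A(log(T+h) + log T)`), and from Corollary 1
(`A = 0.28`): `BrentPlattTrudgian2022_cor1.sum_inv_sq_le` (= Lemma 5), `.lehman_abs`,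
`.abs_sum_inv_sub_le`, `.window_le`, `.count_le/le_count`, `.count_le_simple`
(`N(T) ≤ T log T/(2π)` for `T ≥ 2π`); and the explicit `S(T)` bounds
`BrentPlattTrudgian2022_lemma1.abs_zetaArgS_le` (`0.11 log T + 0.29 log log T + 2.29 + 0.2/T + 1/(150T)`,
`T ≥ 2πe`) and `BrentPlattTrudgian2022_cor1.abs_zetaArgS_le` (`0.28 log T + 1/(150T)`, `T ≥ 2π`)
from the `N(T)` facts and `BrentPlattTrudgian2021_lemma2`.
Deliberately NOT here: BPT 2021 Lemma 3 / Theorems 1–3 (the `S₁`-refined error `E₂` with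
Trudgian's `A₀ = 2.067`, `A₁ = 0.059` and the "small computation" on `[2π, 168π]`), Lemmas 6–7 of
BPT 2022 (`Σ log^k(γ/2π)/γ²`), the mean-square theorems themselves (RH-conditional `I(X)`), and
Lehman's lemma for merely monotone `φ`.

## References

* R. P. Brent, D. J. Platt, T. S. Trudgian, J. Number Theory 238 (2022) 740–762, §2: Lemma 1,
  Cor. 1, Lemmas 2–5, 8. [BrentPlattTrudgian2022]
* R. P. Brent, D. J. Platt, T. S. Trudgian, Math. Comp. 90 (2021) 2923–2935, Lemmas 1–2,
  Thm. 1, Cor. 1. [BrentPlattTrudgian2021]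
* R. P. Brent, D. J. Platt, T. S. Trudgian, Bull. Aust. Math. Soc. 104 (2021) 59–65, Thm. 1.
  [BrentPlattTrudgian2021BAMS]
* R. S. Lehman, *On the difference `π(x) − li(x)`*, Acta Arith. 11 (1966) 397–410, Lemma.
  [Lehman1966]
* J. B. Rosser, L. Schoenfeld, Math. Comp. 29 (1975) 243–269, Lemma 7 (partial summation against
  `N`, the tree's `SchoenfeldBound.sum_zerosBetween_eq`). [RosserSchoenfeld1975]
-/

noncomputable section

open Complex Filter Set MeasureTheory intervalIntegral
open scoped Real

namespace Literature.NumberTheory.LFunctions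

open SchoenfeldBound

/-! ## Named facts -/

/-- NAMED FACT (**Brent–Platt–Trudgian 2022, Lemma 1** "Backlund–Platt–Trudgian", as printed:
"For all `T ≥ 2πe`, `N(T) = (T/2π) log(T/2π) − T/2π + 7/8 + Q(T)`, where
`|Q(T)| ≤ 0.11 log T + 0.29 log log T + 2.29 + 0.2/T`" — Platt–Trudgian 2015, Cor. 1, with
Trudgian 2014). Unconditional. Users take `(h : BrentPlattTrudgian2022_lemma1)`.
[cite: BrentPlattTrudgian2022, Lemma 1] -/
def BrentPlattTrudgian2022_lemma1 : Prop :=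
  ∀ T : ℝ, 2 * π * Real.exp 1 ≤ T →
    |(zetaZeroCount T : ℝ) - countMain T| ≤
      0.11 * Real.log T + 0.29 * Real.log (Real.log T) + 2.29 + 0.2 / T

/-- NAMED FACT (**Brent–Platt–Trudgian 2022, Corollary 1**, as printed: "For all `T ≥ 2π`,
`N(T) = (T/2π) log(T/2π) − T/2π + 7/8 + (0.28ϑ) log T`", `|ϑ| ≤ 1`; proof: Lemma 1 for
`T ≥ 1.03·10⁸`, an interval-arithmetic verification with the zeros of ordinate `< 1.03·10⁸`
below). Unconditional (part computational). Users take `(h : BrentPlattTrudgian2022_cor1)`.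
[cite: BrentPlattTrudgian2022, Cor. 1] -/
def BrentPlattTrudgian2022_cor1 : Prop :=
  ∀ T : ℝ, 2 * π ≤ T → |(zetaZeroCount T : ℝ) - countMain T| ≤ 0.28 * Real.log T

/-- NAMED FACT (**Brent–Platt–Trudgian 2022, Lemma 8**, as printed: "If `T ≥ 4πe`, then
`Σ_{0<γ≤T} 1/γ ≤ L̂²/(4π)`", `L̂ = log(T/2π)`, ordinates with multiplicity; proof: Lehman's lemma
with `A = 0.28` from `T₁ = 202`, the first `80` zeros, and a numerical check on `[4πe, 202)`;
improves Saouter–Trudgian–Demichel). In the tree's vocabulary the sum is over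
`zerosBetween 0 T`. Unconditional (part computational). Users take
`(h : BrentPlattTrudgian2022_lemma8)`. [cite: BrentPlattTrudgian2022, Lemma 8] -/
def BrentPlattTrudgian2022_lemma8 : Prop :=
  ∀ T : ℝ, 4 * π * Real.exp 1 ≤ T →
    ∑ ρ ∈ zerosBetween 0 T, (riemannZetaZeroOrder ρ : ℝ) / ρ.im ≤ Real.log (T / (2 * π)) ^ 2 / (4 * π)

/-- NAMED FACT (**Brent–Platt–Trudgian 2021, Lemma 2**, as printed: "If `Q(t)` and `S(t)` are
defined as above then, for all `t ≥ 2π`, `|Q(t) − S(t)| ≤ 1/(150t)`"; `Q = N − L`, and by the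
Riemann–von Mangoldt formula `N = θ/π + 1 + S` — in the tree the DEFINITION of
`zetaArgS` — this reads `|θ(t)/π + 1 − L(t)| ≤ 1/(150t)`; proof from Brent's explicit remainder
for Stirling's series of `θ` with `k = 3` terms; "the constant `150` could at best be replaced by
`48π ≈ 150.8`"). Unconditional. Users take `(h : BrentPlattTrudgian2021_lemma2)`.
KERNEL STATUS (2026-08-27): DISCHARGED — `BrentPlattTrudgian2021_lemma2_holds`
(`RiemannSiegelStirlingThirdOrder.lean`, third-order Stirling for `θ`; standard axioms).
[cite: BrentPlattTrudgian2021, Lemma 2] -/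
def BrentPlattTrudgian2021_lemma2 : Prop :=
  ∀ t : ℝ, 2 * π ≤ t →
    |((zetaZeroCount t : ℝ) - countMain t) - zetaArgS t| ≤ 1 / (150 * t)

/-- NAMED FACT (**Brent–Platt–Trudgian 2021, the standing condition (2.9) on `[2π, ∞)`**, as
printed (§2, eq. (2.9) and the sentence after it): "From [Trudgian 2011],
`|S₁(T) − c₀| ≤ A₀ + A₁ log T` for all `T ≥ 168π`, where `c₀ = S₁(168π)`, `A₀ = 2.067`, and
`A₁ = 0.059`. However, a small computation shows that (2.9) also holds for `T ∈ [2π, 168π]`."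
Here `S₁(T) − c₀ = ∫_{168π}^T S(t) dt` with the tree's `S = zetaArgS = N − θ/π − 1`
(right-continuous; the integral does not depend on the convention at the ordinates). For
`T > 168π` this is Trudgian 2011, Thm. 2.2 — in the tree the THEOREM
`Literature.NumberTheory.LFunctions.abs_integral_zetaArgS_le_trudgian_holds` (`TuringMethodProofs.lean`;
the lower limit `168π` itself by continuity of the primitive) — so the content of this fact is the
numerical verification on `[2π, 168π]`. It is the hypothesis under which Brent–Platt–Trudgian's
refined Lehman lemma (their Lemma 3 and Theorems 1–3, error `E₂`) holds from `T₀ = 2π` on.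
Unconditional (part computational). Users take `(h : BrentPlattTrudgian2021_eq29)`.
KERNEL STATUS (2026-08-27): DISCHARGED — `BrentPlattTrudgian2021_eq29_holds`
(`ZetaArgSIntegralLowHeightNumerics.lean`: the "small computation" on `[2π, 168π]` as a kernel interval
computation over the tree's certified first `2000` zeros, `2087` cells, margins `≥ 1.5`; computational
lane). Hypothesis-free forms of the consumers: `ZetaZeroSumsLehmanPrintedUnconditional.lean`.
[cite: BrentPlattTrudgian2021, §2 eq. (2.9)] [cite: Trudgian2011, Thm. 2.2] -/
def BrentPlattTrudgian2021_eq29 : Prop :=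
  ∀ T : ℝ, 2 * π ≤ T → |∫ t in (168 * π)..T, zetaArgS t| ≤ 2.067 + 0.059 * Real.log T

namespace BPT2021

/-- The printed `28`-digit centre of `c₁ = Σ_{γ>0} 1/γ²` (Corollary 1).
[cite: BrentPlattTrudgian2021, Cor. 1] -/
def c₁ : ℝ := 0.0231049931154189707889338104

/-- The printed radius `5·10⁻²⁸` of Corollary 1. [cite: BrentPlattTrudgian2021, Cor. 1] -/
def c₁err : ℝ := 5e-28

/-- The printed `18`-digit centre of the constant `H` (Brent–Platt–Trudgian, Bull. Aust. Math.
Soc. 2021, Thm. 1; quoted in the Math. Comp. paper, §1). [cite: BrentPlattTrudgian2021BAMS, Thm. 1] -/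
def H : ℝ := -0.0171594043070981495

end BPT2021

/-- NAMED FACT (**Brent–Platt–Trudgian 2021, Corollary 1**, as printed:
"`c₁ = Σ_{γ>0} 1/γ² = 0.0231049931154189707889338104 + ϑ(5·10⁻²⁸)`", by Theorem 1 and an
interval-arithmetic computation with the first `10¹⁰` zeros). Typed on the finite truncations
`Σ_{0<γ≤U} m(ρ)/γ²` (non-negative terms, so the series' value is their supremum): every truncation
is `≤ c₁ + 5·10⁻²⁸`, and truncations come within any `ε` of `c₁ − 5·10⁻²⁸`. Unconditional
(computational). Users take `(h : BrentPlattTrudgian2021_cor1)`. [cite: BrentPlattTrudgian2021, Cor. 1] -/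
def BrentPlattTrudgian2021_cor1 : Prop :=
  (∀ U : ℝ, ∑ ρ ∈ zerosBetween 0 U, (riemannZetaZeroOrder ρ : ℝ) / ρ.im ^ 2 ≤
      BPT2021.c₁ + BPT2021.c₁err) ∧
    ∀ ε : ℝ, 0 < ε → ∃ U : ℝ,
      BPT2021.c₁ - BPT2021.c₁err - ε ≤ ∑ ρ ∈ zerosBetween 0 U, (riemannZetaZeroOrder ρ : ℝ) / ρ.im ^ 2

/-- NAMED FACT (**Brent–Platt–Trudgian 2021 (Bull. Aust. Math. Soc.), Theorem 1 with
Corollary 1**, as printed: "The limit `H` in (1) exists" —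
`H := lim_{T→∞} (Σ_{0<γ≤T} 1/γ − log²(T/2π)/(4π))` — and
"`H = −0.0171594043070981495 + ϑ(10⁻¹⁸)`" (Thm. 2 there plus an interval-arithmetic computation
with the first `10¹⁰` zeros); quoted in the Math. Comp. paper, §1). Unconditional (part
computational). Users take `(h : BrentPlattTrudgian2021BAMS_thm1)`.
[cite: BrentPlattTrudgian2021BAMS, Thm. 1 and Cor. 1] [cite: BrentPlattTrudgian2021, §1] -/
def BrentPlattTrudgian2021BAMS_thm1 : Prop :=
  ∃ H : ℝ, |H - BPT2021.H| ≤ 1e-18 ∧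
    Tendsto (fun T : ℝ ↦ ∑ ρ ∈ zerosBetween 0 T, (riemannZetaZeroOrder ρ : ℝ) / ρ.im
        - Real.log (T / (2 * π)) ^ 2 / (4 * π)) atTop (nhds H)

/-! ## Backlund's main term is differentiable: `L'(t) = log(t/2π)/(2π)` -/

/-- `d/dt [(t/2π) log(t/2π) − t/2π + 7/8] = log(t/2π)/(2π)` for `t > 0`. [folklore]
[cite: BrentPlattTrudgian2022, §2 (eq. for L(T))] -/
theorem hasDerivAt_countMain {t : ℝ} (ht : 0 < t) :
    HasDerivAt countMain (Real.log (t / (2 * π)) / (2 * π)) t := by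
  have h2π : (0 : ℝ) < 2 * π := by positivity
  have h1 : HasDerivAt (fun s : ℝ ↦ s / (2 * π)) (1 / (2 * π)) t := by
    simpa using (hasDerivAt_id t).div_const (2 * π)
  have hlog : HasDerivAt (fun s : ℝ ↦ Real.log (s / (2 * π))) (1 / t) t := by
    have h2 := (Real.hasDerivAt_log (div_pos ht h2π).ne').comp t h1
    have e : (t / (2 * π))⁻¹ * (1 / (2 * π)) = 1 / t := by
      field_simp
    rw [e] at h2
    exact h2
  have h := ((h1.mul hlog).sub h1).add_const (7 / 8)
  have e2 : 1 / (2 * π) * Real.log (t / (2 * π)) + t / (2 * π) * (1 / t) - 1 / (2 * π) =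
      Real.log (t / (2 * π)) / (2 * π) := by
    field_simp
    ring
  rw [e2] at h
  exact h

/-- `countMain` is continuous on `[a, b]` for `a > 0`. [folklore] [cite: BrentPlattTrudgian2022, §2] -/
theorem continuousOn_countMain {a b : ℝ} (ha : 0 < a) : ContinuousOn countMain (Icc a b) :=
  fun _ ht ↦ (hasDerivAt_countMain (ha.trans_le ht.1)).continuousAt.continuousWithinAt

/-! ## Lehman's lemma (proved, `C¹` form) -/

/-- **Lehman's lemma, the exact remainder.** For `0 < T₁ ≤ T₂` and `φ ∈ C¹[T₁, T₂]`, with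
`Q(t) = N(t) − L(t)`:
`Σ_{T₁<γ≤T₂} m(ρ) φ(γ) = (1/2π)∫_{T₁}^{T₂} φ(t) log(t/2π) dt + Q(T₂)φ(T₂) − Q(T₁)φ(T₁) − ∫_{T₁}^{T₂} Q(t) φ'(t) dt`
(Lehman 1966, proof of the Lemma; Brent–Platt–Trudgian 2021, (3.3) with `L` absorbed).
[cite: BrentPlattTrudgian2021, Lemma 3 eq. (3.3)] [cite: BrentPlattTrudgian2022, Lemma 2] -/
theorem lehman_identity {T₁ T₂ : ℝ} (h0 : 0 < T₁) (h12 : T₁ ≤ T₂) {φ φ' : ℝ → ℝ}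
    (hφ : ∀ t ∈ Icc T₁ T₂, HasDerivAt φ (φ' t) t) (hφ' : ContinuousOn φ' (Icc T₁ T₂)) :
    ∑ ρ ∈ zerosBetween T₁ T₂, (riemannZetaZeroOrder ρ : ℝ) * φ ρ.im =
      (∫ t in T₁..T₂, φ t * Real.log (t / (2 * π))) / (2 * π)
        + ((zetaZeroCount T₂ : ℝ) - countMain T₂) * φ T₂
        - ((zetaZeroCount T₁ : ℝ) - countMain T₁) * φ T₁
        - ∫ t in T₁..T₂, ((zetaZeroCount t : ℝ) - countMain t) * φ' t := by
  have hIcc : uIcc T₁ T₂ = Icc T₁ T₂ := uIcc_of_le h12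
  rw [sum_zerosBetween_eq h0.le h12 hφ hφ']
  -- integrability facts
  have hφ'i : IntervalIntegrable φ' volume T₁ T₂ := hφ'.intervalIntegrable_of_Icc h12
  have hNi : IntervalIntegrable (fun t ↦ ((zetaZeroCount t : ℝ) - zetaZeroCount T₁) * φ' t)
      volume T₁ T₂ := intervalIntegrable_count_sub_mul (by rw [hIcc]; exact hφ')
  have hcMc : ContinuousOn countMain (Icc T₁ T₂) := continuousOn_countMain h0
  have hcMd : ∀ t ∈ uIcc T₁ T₂, HasDerivAt countMain (Real.log (t / (2 * π)) / (2 * π)) t := by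
    intro t ht; rw [hIcc] at ht; exact hasDerivAt_countMain (h0.trans_le ht.1)
  have hφd : ∀ t ∈ uIcc T₁ T₂, HasDerivAt φ (φ' t) t := by
    intro t ht; rw [hIcc] at ht; exact hφ t ht
  have hlogc : ContinuousOn (fun t : ℝ ↦ Real.log (t / (2 * π)) / (2 * π)) (Icc T₁ T₂) := by
    intro t ht
    have ht0 : 0 < t := h0.trans_le ht.1
    exact ((Real.continuousAt_log (by positivity)).comp
      (continuousAt_id.div_const _)).div_const _ |>.continuousWithinAt
  have hlogi : IntervalIntegrable (fun t : ℝ ↦ Real.log (t / (2 * π)) / (2 * π)) volume T₁ T₂ :=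
    hlogc.intervalIntegrable_of_Icc h12
  -- integration by parts for the main term: ∫ (cM t) φ' = cM₂ φ₂ - cM₁ φ₁ - ∫ cM' φ
  have hparts : ∫ t in T₁..T₂, countMain t * φ' t =
      countMain T₂ * φ T₂ - countMain T₁ * φ T₁
        - ∫ t in T₁..T₂, Real.log (t / (2 * π)) / (2 * π) * φ t :=
    integral_mul_deriv_eq_deriv_mul hcMd hφd hlogi hφ'i
  have hcMi : IntervalIntegrable (fun t ↦ countMain t * φ' t) volume T₁ T₂ :=
    (hcMc.mul hφ').intervalIntegrable_of_Icc h12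
  have hconst : ∫ t in T₁..T₂, (zetaZeroCount T₁ : ℝ) * φ' t =
      (zetaZeroCount T₁ : ℝ) * (φ T₂ - φ T₁) := by
    rw [intervalIntegral.integral_const_mul, integral_eq_sub_of_hasDerivAt hφd hφ'i]
  -- split N(t) - N(T₁) = (N t - cM t) + cM t - N T₁
  have hQi : IntervalIntegrable (fun t ↦ ((zetaZeroCount t : ℝ) - countMain t) * φ' t)
      volume T₁ T₂ := by
    have : (fun t ↦ ((zetaZeroCount t : ℝ) - countMain t) * φ' t) =
        fun t ↦ ((zetaZeroCount t : ℝ) - zetaZeroCount T₁) * φ' t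
          + ((zetaZeroCount T₁ : ℝ) * φ' t - countMain t * φ' t) := by
      funext t; ring
    rw [this]
    exact hNi.add ((hφ'i.const_mul _).sub hcMi)
  have hKi : IntervalIntegrable (fun t ↦ (zetaZeroCount T₁ : ℝ) * φ' t) volume T₁ T₂ :=
    hφ'i.const_mul _
  have hsplit : ∫ t in T₁..T₂, ((zetaZeroCount t : ℝ) - zetaZeroCount T₁) * φ' t =
      (∫ t in T₁..T₂, ((zetaZeroCount t : ℝ) - countMain t) * φ' t)
        + (∫ t in T₁..T₂, countMain t * φ' t)
        - ∫ t in T₁..T₂, (zetaZeroCount T₁ : ℝ) * φ' t := by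
    rw [← intervalIntegral.integral_add hQi hcMi, ← intervalIntegral.integral_sub (hQi.add hcMi) hKi]
    refine intervalIntegral.integral_congr fun t _ ↦ ?_
    ring
  rw [hsplit, hparts, hconst]
  have e : ∫ t in T₁..T₂, Real.log (t / (2 * π)) / (2 * π) * φ t =
      (∫ t in T₁..T₂, φ t * Real.log (t / (2 * π))) / (2 * π) := by
    rw [div_eq_inv_mul _ (2 * π), ← intervalIntegral.integral_const_mul]
    refine intervalIntegral.integral_congr fun t _ ↦ ?_
    ring
  rw [e]
  ring

/-- For `φ ∈ C¹[T₁, T₂]` with `φ' ≤ 0`: `φ(T₂) ≤ φ(T₁)`. [folklore] -/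
private theorem phi_anti {T₁ T₂ : ℝ} (h12 : T₁ ≤ T₂) {φ φ' : ℝ → ℝ}
    (hφ : ∀ t ∈ Icc T₁ T₂, HasDerivAt φ (φ' t) t) (hφ' : ContinuousOn φ' (Icc T₁ T₂))
    (hφ'0 : ∀ t ∈ Icc T₁ T₂, φ' t ≤ 0) : φ T₂ ≤ φ T₁ := by
  have hIcc : uIcc T₁ T₂ = Icc T₁ T₂ := uIcc_of_le h12
  have hφd : ∀ t ∈ uIcc T₁ T₂, HasDerivAt φ (φ' t) t := by
    intro t ht; rw [hIcc] at ht; exact hφ t ht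
  have h := integral_eq_sub_of_hasDerivAt hφd (hφ'.intervalIntegrable_of_Icc h12)
  have hnn : 0 ≤ ∫ t in T₁..T₂, -φ' t :=
    intervalIntegral.integral_nonneg h12 fun t ht ↦ by linarith [hφ'0 t ht]
  rw [intervalIntegral.integral_neg] at hnn
  linarith

/-- **Lehman's lemma, upper half** (Brent–Platt–Trudgian 2022, Lemma 2 "Lehman-decreasing";
Lehman 1966): if `|N(t) − L(t)| ≤ A log t` for all `t ≥ 2π`, then for `2π ≤ T₁ ≤ T₂` and
`φ ∈ C¹[T₁,T₂]` non-increasing (`φ' ≤ 0`) with `φ(T₂) ≥ 0`,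
`Σ_{T₁<γ≤T₂} m(ρ)φ(γ) ≤ (1/2π)∫_{T₁}^{T₂} φ(t)log(t/2π) dt + A(2φ(T₁)log T₁ + ∫_{T₁}^{T₂} φ(t)/t dt)`.
(The source asks `T₁ ≥ 2πe`; with the `A`-bound from `2π` on, `T₁ ≥ 2π` suffices.)
[cite: BrentPlattTrudgian2022, Lemma 2] -/
theorem lehman_sum_le {A T₁ T₂ : ℝ}
    (hA : ∀ t : ℝ, 2 * π ≤ t → |(zetaZeroCount t : ℝ) - countMain t| ≤ A * Real.log t)
    (h1 : 2 * π ≤ T₁) (h12 : T₁ ≤ T₂) {φ φ' : ℝ → ℝ}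
    (hφ : ∀ t ∈ Icc T₁ T₂, HasDerivAt φ (φ' t) t) (hφ' : ContinuousOn φ' (Icc T₁ T₂))
    (hφ'0 : ∀ t ∈ Icc T₁ T₂, φ' t ≤ 0) (hφT : 0 ≤ φ T₂) :
    ∑ ρ ∈ zerosBetween T₁ T₂, (riemannZetaZeroOrder ρ : ℝ) * φ ρ.im ≤
      (∫ t in T₁..T₂, φ t * Real.log (t / (2 * π))) / (2 * π)
        + A * (2 * φ T₁ * Real.log T₁ + ∫ t in T₁..T₂, φ t / t) := by
  have hπ : 3 < π := Real.pi_gt_three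
  have h0 : 0 < T₁ := by linarith
  have hIcc : uIcc T₁ T₂ = Icc T₁ T₂ := uIcc_of_le h12
  have hφ1 : 0 ≤ φ T₁ := hφT.trans (phi_anti h12 hφ hφ' hφ'0)
  rw [lehman_identity h0 h12 hφ hφ']
  set Q : ℝ → ℝ := fun t ↦ (zetaZeroCount t : ℝ) - countMain t with hQdef
  have hQ : ∀ t ∈ Icc T₁ T₂, |Q t| ≤ A * Real.log t := fun t ht ↦ hA t (h1.trans ht.1)
  have hL1 : 0 ≤ Real.log T₁ := Real.log_nonneg (by linarith)
  have hL2 : 0 ≤ Real.log T₂ := Real.log_nonneg (by linarith)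
  -- the boundary terms
  have hb2 : Q T₂ * φ T₂ ≤ A * Real.log T₂ * φ T₂ := by
    have := hQ T₂ ⟨h12, le_rfl⟩
    have hq : Q T₂ ≤ A * Real.log T₂ := (le_abs_self _).trans this
    exact mul_le_mul_of_nonneg_right hq hφT
  have hb1 : -(Q T₁ * φ T₁) ≤ A * Real.log T₁ * φ T₁ := by
    have := hQ T₁ ⟨le_rfl, h12⟩
    have hq : -Q T₁ ≤ A * Real.log T₁ := (neg_le_abs _).trans this
    nlinarith
  -- the integral term: -∫ Q φ' ≤ ∫ A log t (-φ' t) = A (L₁ φ₁ - L₂ φ₂ + ∫ φ/t)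
  have hφ'i : IntervalIntegrable φ' volume T₁ T₂ := hφ'.intervalIntegrable_of_Icc h12
  have hcMc : ContinuousOn countMain (Icc T₁ T₂) := continuousOn_countMain h0
  have hQi : IntervalIntegrable (fun t ↦ Q t * φ' t) volume T₁ T₂ := by
    have hNi : IntervalIntegrable (fun t ↦ ((zetaZeroCount t : ℝ) - zetaZeroCount T₁) * φ' t)
        volume T₁ T₂ := intervalIntegrable_count_sub_mul (by rw [hIcc]; exact hφ')
    have hcMi : IntervalIntegrable (fun t ↦ countMain t * φ' t) volume T₁ T₂ :=
      (hcMc.mul hφ').intervalIntegrable_of_Icc h12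
    have : (fun t ↦ Q t * φ' t) = fun t ↦ ((zetaZeroCount t : ℝ) - zetaZeroCount T₁) * φ' t
        + ((zetaZeroCount T₁ : ℝ) * φ' t - countMain t * φ' t) := by
      funext t; simp only [hQdef]; ring
    rw [this]
    exact hNi.add ((hφ'i.const_mul _).sub hcMi)
  have hlogc : ContinuousOn (fun t : ℝ ↦ Real.log t) (Icc T₁ T₂) := fun t ht ↦
    (Real.continuousAt_log (by linarith [ht.1] : t ≠ 0)).continuousWithinAt
  have hlogφ'i : IntervalIntegrable (fun t ↦ A * Real.log t * (-φ' t)) volume T₁ T₂ :=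
    ((continuousOn_const.mul hlogc).mul hφ'.neg).intervalIntegrable_of_Icc h12
  have hint_le : -(∫ t in T₁..T₂, Q t * φ' t) ≤ ∫ t in T₁..T₂, A * Real.log t * (-φ' t) := by
    rw [← intervalIntegral.integral_neg]
    refine intervalIntegral.integral_mono_on h12 hQi.neg hlogφ'i fun t ht ↦ ?_
    have h1' := hQ t ht
    have h2' := hφ'0 t ht
    have : -(Q t * φ' t) ≤ |Q t| * (-φ' t) := by
      have := neg_abs_le (Q t)
      have := le_abs_self (Q t)
      nlinarith
    calc -(Q t * φ' t) ≤ |Q t| * (-φ' t) := this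
      _ ≤ A * Real.log t * (-φ' t) := mul_le_mul_of_nonneg_right h1' (by linarith)
  -- ∫ log t (-φ') by parts
  have hlogd : ∀ t ∈ uIcc T₁ T₂, HasDerivAt (fun s : ℝ ↦ Real.log s) (1 / t) t := by
    intro t ht; rw [hIcc] at ht
    have ht0 : t ≠ 0 := by linarith [ht.1]
    simpa [one_div] using Real.hasDerivAt_log ht0
  have hφd : ∀ t ∈ uIcc T₁ T₂, HasDerivAt φ (φ' t) t := by
    intro t ht; rw [hIcc] at ht; exact hφ t ht
  have hinvi : IntervalIntegrable (fun t : ℝ ↦ 1 / t) volume T₁ T₂ := by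
    refine (continuousOn_const.div continuousOn_id fun t ht ↦ ?_).intervalIntegrable_of_Icc h12
    exact (by linarith [ht.1] : (t : ℝ) ≠ 0)
  have hparts : ∫ t in T₁..T₂, Real.log t * φ' t =
      Real.log T₂ * φ T₂ - Real.log T₁ * φ T₁ - ∫ t in T₁..T₂, 1 / t * φ t :=
    integral_mul_deriv_eq_deriv_mul hlogd hφd hinvi hφ'i
  have hlogφi : IntervalIntegrable (fun t ↦ Real.log t * φ' t) volume T₁ T₂ :=
    (hlogc.mul hφ').intervalIntegrable_of_Icc h12
  have hval : ∫ t in T₁..T₂, A * Real.log t * (-φ' t) =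
      A * (Real.log T₁ * φ T₁ - Real.log T₂ * φ T₂ + ∫ t in T₁..T₂, φ t / t) := by
    have e1 : (fun t ↦ A * Real.log t * (-φ' t)) = fun t ↦ (-A) * (Real.log t * φ' t) := by
      funext t; ring
    rw [e1, intervalIntegral.integral_const_mul, hparts]
    have e2 : ∫ t in T₁..T₂, 1 / t * φ t = ∫ t in T₁..T₂, φ t / t :=
      intervalIntegral.integral_congr fun t _ ↦ by ring
    rw [e2]; ring
  rw [hval] at hint_le
  have hφTL : 0 ≤ A * Real.log T₂ * φ T₂ - Q T₂ * φ T₂ := by linarith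
  nlinarith [hb1, hb2, hint_le, hL2, hφT]

/-- **Lehman's lemma, lower half**: under the same hypotheses,
`Σ_{T₁<γ≤T₂} m(ρ)φ(γ) ≥ (1/2π)∫_{T₁}^{T₂} φ(t)log(t/2π) dt − A(2φ(T₁)log T₁ + ∫_{T₁}^{T₂} φ(t)/t dt)`.
[cite: BrentPlattTrudgian2022, Lemma 2] -/
theorem lehman_le_sum {A T₁ T₂ : ℝ}
    (hA : ∀ t : ℝ, 2 * π ≤ t → |(zetaZeroCount t : ℝ) - countMain t| ≤ A * Real.log t)
    (h1 : 2 * π ≤ T₁) (h12 : T₁ ≤ T₂) {φ φ' : ℝ → ℝ}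
    (hφ : ∀ t ∈ Icc T₁ T₂, HasDerivAt φ (φ' t) t) (hφ' : ContinuousOn φ' (Icc T₁ T₂))
    (hφ'0 : ∀ t ∈ Icc T₁ T₂, φ' t ≤ 0) (hφT : 0 ≤ φ T₂) :
    (∫ t in T₁..T₂, φ t * Real.log (t / (2 * π))) / (2 * π)
        - A * (2 * φ T₁ * Real.log T₁ + ∫ t in T₁..T₂, φ t / t) ≤
      ∑ ρ ∈ zerosBetween T₁ T₂, (riemannZetaZeroOrder ρ : ℝ) * φ ρ.im := by
  have hπ : 3 < π := Real.pi_gt_three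
  have h0 : 0 < T₁ := by linarith
  have hIcc : uIcc T₁ T₂ = Icc T₁ T₂ := uIcc_of_le h12
  have hφ1 : 0 ≤ φ T₁ := hφT.trans (phi_anti h12 hφ hφ' hφ'0)
  rw [lehman_identity h0 h12 hφ hφ']
  set Q : ℝ → ℝ := fun t ↦ (zetaZeroCount t : ℝ) - countMain t with hQdef
  have hQ : ∀ t ∈ Icc T₁ T₂, |Q t| ≤ A * Real.log t := fun t ht ↦ hA t (h1.trans ht.1)
  have hL1 : 0 ≤ Real.log T₁ := Real.log_nonneg (by linarith)
  have hL2 : 0 ≤ Real.log T₂ := Real.log_nonneg (by linarith)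
  have hb2 : -(A * Real.log T₂ * φ T₂) ≤ Q T₂ * φ T₂ := by
    have := hQ T₂ ⟨h12, le_rfl⟩
    have hq : -(A * Real.log T₂) ≤ Q T₂ := by linarith [neg_abs_le (Q T₂)]
    nlinarith
  have hb1 : Q T₁ * φ T₁ ≤ A * Real.log T₁ * φ T₁ := by
    have := hQ T₁ ⟨le_rfl, h12⟩
    have hq : Q T₁ ≤ A * Real.log T₁ := (le_abs_self _).trans this
    exact mul_le_mul_of_nonneg_right hq hφ1
  have hφ'i : IntervalIntegrable φ' volume T₁ T₂ := hφ'.intervalIntegrable_of_Icc h12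
  have hcMc : ContinuousOn countMain (Icc T₁ T₂) := continuousOn_countMain h0
  have hQi : IntervalIntegrable (fun t ↦ Q t * φ' t) volume T₁ T₂ := by
    have hNi : IntervalIntegrable (fun t ↦ ((zetaZeroCount t : ℝ) - zetaZeroCount T₁) * φ' t)
        volume T₁ T₂ := intervalIntegrable_count_sub_mul (by rw [hIcc]; exact hφ')
    have hcMi : IntervalIntegrable (fun t ↦ countMain t * φ' t) volume T₁ T₂ :=
      (hcMc.mul hφ').intervalIntegrable_of_Icc h12
    have : (fun t ↦ Q t * φ' t) = fun t ↦ ((zetaZeroCount t : ℝ) - zetaZeroCount T₁) * φ' t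
        + ((zetaZeroCount T₁ : ℝ) * φ' t - countMain t * φ' t) := by
      funext t; simp only [hQdef]; ring
    rw [this]
    exact hNi.add ((hφ'i.const_mul _).sub hcMi)
  have hlogc : ContinuousOn (fun t : ℝ ↦ Real.log t) (Icc T₁ T₂) := fun t ht ↦
    (Real.continuousAt_log (by linarith [ht.1] : t ≠ 0)).continuousWithinAt
  have hlogφ'i : IntervalIntegrable (fun t ↦ A * Real.log t * (-φ' t)) volume T₁ T₂ :=
    ((continuousOn_const.mul hlogc).mul hφ'.neg).intervalIntegrable_of_Icc h12
  have hint_le : (∫ t in T₁..T₂, Q t * φ' t) ≤ ∫ t in T₁..T₂, A * Real.log t * (-φ' t) := by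
    refine intervalIntegral.integral_mono_on h12 hQi hlogφ'i fun t ht ↦ ?_
    have h1' := hQ t ht
    have h2' := hφ'0 t ht
    have : Q t * φ' t ≤ |Q t| * (-φ' t) := by
      have := neg_abs_le (Q t)
      nlinarith
    calc Q t * φ' t ≤ |Q t| * (-φ' t) := this
      _ ≤ A * Real.log t * (-φ' t) := mul_le_mul_of_nonneg_right h1' (by linarith)
  have hlogd : ∀ t ∈ uIcc T₁ T₂, HasDerivAt (fun s : ℝ ↦ Real.log s) (1 / t) t := by
    intro t ht; rw [hIcc] at ht
    have ht0 : t ≠ 0 := by linarith [ht.1]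
    simpa [one_div] using Real.hasDerivAt_log ht0
  have hφd : ∀ t ∈ uIcc T₁ T₂, HasDerivAt φ (φ' t) t := by
    intro t ht; rw [hIcc] at ht; exact hφ t ht
  have hinvi : IntervalIntegrable (fun t : ℝ ↦ 1 / t) volume T₁ T₂ := by
    refine (continuousOn_const.div continuousOn_id fun t ht ↦ ?_).intervalIntegrable_of_Icc h12
    exact (by linarith [ht.1] : (t : ℝ) ≠ 0)
  have hparts : ∫ t in T₁..T₂, Real.log t * φ' t =
      Real.log T₂ * φ T₂ - Real.log T₁ * φ T₁ - ∫ t in T₁..T₂, 1 / t * φ t :=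
    integral_mul_deriv_eq_deriv_mul hlogd hφd hinvi hφ'i
  have hval : ∫ t in T₁..T₂, A * Real.log t * (-φ' t) =
      A * (Real.log T₁ * φ T₁ - Real.log T₂ * φ T₂ + ∫ t in T₁..T₂, φ t / t) := by
    have e1 : (fun t ↦ A * Real.log t * (-φ' t)) = fun t ↦ (-A) * (Real.log t * φ' t) := by
      funext t; ring
    rw [e1, intervalIntegral.integral_const_mul, hparts]
    have e2 : ∫ t in T₁..T₂, 1 / t * φ t = ∫ t in T₁..T₂, φ t / t :=
      intervalIntegral.integral_congr fun t _ ↦ by ring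
    rw [e2]; ring
  rw [hval] at hint_le
  nlinarith [hb1, hb2, hint_le, hL2, hφT]

/-- **Lehman's lemma** (two-sided; Brent–Platt–Trudgian 2022, Lemma 2 / 2021, Lemma 1; Lehman
1966): `|Σ_{T₁<γ≤T₂} m(ρ)φ(γ) − (1/2π)∫_{T₁}^{T₂} φ log(t/2π)| ≤ A(2φ(T₁) log T₁ + ∫_{T₁}^{T₂} φ/t)`.
[cite: BrentPlattTrudgian2022, Lemma 2] [cite: BrentPlattTrudgian2021, Lemma 1] -/
theorem abs_lehman {A T₁ T₂ : ℝ}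
    (hA : ∀ t : ℝ, 2 * π ≤ t → |(zetaZeroCount t : ℝ) - countMain t| ≤ A * Real.log t)
    (h1 : 2 * π ≤ T₁) (h12 : T₁ ≤ T₂) {φ φ' : ℝ → ℝ}
    (hφ : ∀ t ∈ Icc T₁ T₂, HasDerivAt φ (φ' t) t) (hφ' : ContinuousOn φ' (Icc T₁ T₂))
    (hφ'0 : ∀ t ∈ Icc T₁ T₂, φ' t ≤ 0) (hφT : 0 ≤ φ T₂) :
    |∑ ρ ∈ zerosBetween T₁ T₂, (riemannZetaZeroOrder ρ : ℝ) * φ ρ.im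
        - (∫ t in T₁..T₂, φ t * Real.log (t / (2 * π))) / (2 * π)| ≤
      A * (2 * φ T₁ * Real.log T₁ + ∫ t in T₁..T₂, φ t / t) := by
  rw [abs_le]
  constructor
  · linarith [lehman_le_sum hA h1 h12 hφ hφ' hφ'0 hφT]
  · linarith [lehman_sum_le hA h1 h12 hφ hφ' hφ'0 hφT]

/-! ## `Σ_{T<γ≤U} 1/γ²` (Brent–Platt–Trudgian 2022, Lemma 5, proved) -/

/-- `∫_T^U log(t/2π)/t² dt = (log(T/2π)+1)/T − (log(U/2π)+1)/U` for `0 < T ≤ U`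
(the source's `I₁`-type integral). [cite: BrentPlattTrudgian2022, §2 (integrals I_k)] -/
theorem integral_log_div_sq {T U : ℝ} (hT : 0 < T) (hTU : T ≤ U) :
    ∫ t in T..U, 1 / t ^ 2 * Real.log (t / (2 * π)) =
      (Real.log (T / (2 * π)) + 1) / T - (Real.log (U / (2 * π)) + 1) / U := by
  have h2π : (0 : ℝ) < 2 * π := by positivity
  have hIcc : uIcc T U = Icc T U := uIcc_of_le hTU
  have hF : ∀ t ∈ uIcc T U, HasDerivAt (fun s : ℝ ↦ -(Real.log (s / (2 * π)) + 1) / s)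
      (1 / t ^ 2 * Real.log (t / (2 * π))) t := by
    intro t ht
    rw [hIcc] at ht
    have ht0 : 0 < t := hT.trans_le ht.1
    have h1 : HasDerivAt (fun s : ℝ ↦ s / (2 * π)) (1 / (2 * π)) t := by
      simpa using (hasDerivAt_id t).div_const (2 * π)
    have hlog : HasDerivAt (fun s : ℝ ↦ Real.log (s / (2 * π))) (1 / t) t := by
      have h2 := (Real.hasDerivAt_log (div_pos ht0 h2π).ne').comp t h1
      have e : (t / (2 * π))⁻¹ * (1 / (2 * π)) = 1 / t := by field_simp
      rw [e] at h2
      exact h2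
    have h := ((hlog.neg).add_const (-1)).mul (hasDerivAt_inv ht0.ne')
    have h' := h.congr_of_eventuallyEq (f₁ := fun s : ℝ ↦ -(Real.log (s / (2 * π)) + 1) / s)
      (Filter.Eventually.of_forall fun s ↦ by
        simp only [Pi.mul_apply, Pi.neg_apply, div_eq_mul_inv]; ring)
    refine h'.congr_deriv ?_
    simp only [Pi.neg_apply]
    field_simp
    ring
  have hint : IntervalIntegrable (fun t : ℝ ↦ 1 / t ^ 2 * Real.log (t / (2 * π))) volume T U := by
    refine ContinuousOn.intervalIntegrable_of_Icc hTU fun t ht ↦ ?_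
    have ht0 : 0 < t := hT.trans_le ht.1
    have hne : (fun x : ℝ ↦ x ^ 2) t ≠ 0 := by simp only [ne_eq]; positivity
    exact ((continuousAt_const.div (continuousAt_id.pow 2) hne).mul
      ((Real.continuousAt_log (by positivity)).comp (continuousAt_id.div_const _))).continuousWithinAt
  rw [integral_eq_sub_of_hasDerivAt hF hint]
  ring

/-- `∫_T^U (1/t²)/t dt = 1/(2T²) − 1/(2U²)` for `0 < T ≤ U`. [cite: BrentPlattTrudgian2022, §2 (integrals I_k)] -/
theorem integral_inv_sq_div {T U : ℝ} (hT : 0 < T) (hTU : T ≤ U) :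
    ∫ t in T..U, 1 / t ^ 2 / t = 1 / (2 * T ^ 2) - 1 / (2 * U ^ 2) := by
  have hIcc : uIcc T U = Icc T U := uIcc_of_le hTU
  have hF : ∀ t ∈ uIcc T U, HasDerivAt (fun s : ℝ ↦ -1 / (2 * s ^ 2)) (1 / t ^ 2 / t) t := by
    intro t ht
    rw [hIcc] at ht
    have ht0 : 0 < t := hT.trans_le ht.1
    have hd : HasDerivAt (fun s : ℝ ↦ 2 * s ^ 2) (2 * (2 * t)) t := by
      simpa using (hasDerivAt_pow 2 t).const_mul 2
    have h := (hasDerivAt_const t (-1 : ℝ)).div hd (by positivity : (2 : ℝ) * t ^ 2 ≠ 0)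
    have e2 : (0 * (2 * t ^ 2) - -1 * (2 * (2 * t))) / (2 * t ^ 2) ^ 2 = 1 / t ^ 2 / t := by
      field_simp
      ring
    rw [e2] at h
    exact h
  have hint : IntervalIntegrable (fun t : ℝ ↦ 1 / t ^ 2 / t) volume T U := by
    refine ContinuousOn.intervalIntegrable_of_Icc hTU fun t ht ↦ ?_
    have ht0 : 0 < t := hT.trans_le ht.1
    have hne : (fun x : ℝ ↦ x ^ 2) t ≠ 0 := by simp only [ne_eq]; positivity
    have hne' : id t ≠ 0 := by simpa using ht0.ne'
    exact ((continuousAt_const.div (continuousAt_id.pow 2) hne).div continuousAt_id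
      hne').continuousWithinAt
  rw [integral_eq_sub_of_hasDerivAt hF hint]
  ring

/-- **The `A`-explicit tail bound** (the displayed line in the proof of Brent–Platt–Trudgian 2022,
Lemma 5): if `|N(t) − L(t)| ≤ A log t` for `t ≥ 2π`, then for `2π ≤ T ≤ U`,
`Σ_{T<γ≤U} m(ρ)/γ² ≤ (log(T/2π) + 1)/(2πT) + A(4 log T + 1)/(2T²)`
(Lehman's lemma with `φ(t) = 1/t²`, dropping the negative `U`-terms).
[cite: BrentPlattTrudgian2022, Lemma 5 (proof)] -/
theorem sum_inv_sq_le_of_count {A T U : ℝ}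
    (hA : ∀ t : ℝ, 2 * π ≤ t → |(zetaZeroCount t : ℝ) - countMain t| ≤ A * Real.log t)
    (hT : 2 * π ≤ T) (hTU : T ≤ U) :
    ∑ ρ ∈ zerosBetween T U, (riemannZetaZeroOrder ρ : ℝ) * (1 / ρ.im ^ 2) ≤
      (Real.log (T / (2 * π)) + 1) / (2 * π * T) + A * (4 * Real.log T + 1) / (2 * T ^ 2) := by
  have hπ : 3 < π := Real.pi_gt_three
  have h2π : (0 : ℝ) < 2 * π := by positivity
  have hT0 : 0 < T := by linarith
  have hU0 : 0 < U := by linarith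
  -- A ≥ 0 (from the hypothesis at t = T, where log T > 0)
  have hA0 : 0 ≤ A := by
    have h1 := hA T hT
    have hlogT : 0 < Real.log T := Real.log_pos (by linarith)
    have : 0 ≤ A * Real.log T := (abs_nonneg _).trans h1
    nlinarith
  -- Lehman with φ(t) = 1/t²
  have hφ : ∀ t ∈ Icc T U, HasDerivAt (fun s : ℝ ↦ 1 / s ^ 2) (-2 / t ^ 3) t := by
    intro t ht
    have ht0 : 0 < t := hT0.trans_le ht.1
    have hd : HasDerivAt (fun s : ℝ ↦ s ^ 2) (2 * t) t := by simpa using hasDerivAt_pow 2 t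
    have h := (hasDerivAt_const t (1 : ℝ)).div hd (by positivity : t ^ 2 ≠ 0)
    have e2 : (0 * t ^ 2 - 1 * (2 * t)) / (t ^ 2) ^ 2 = -2 / t ^ 3 := by
      field_simp
      ring
    rw [e2] at h
    exact h
  have hφ' : ContinuousOn (fun t : ℝ ↦ -2 / t ^ 3) (Icc T U) := fun t ht ↦ by
    have ht0 : 0 < t := hT0.trans_le ht.1
    have hne : (fun x : ℝ ↦ x ^ 3) t ≠ 0 := by simp only [ne_eq]; positivity
    exact (continuousAt_const.div (continuousAt_id.pow 3) hne).continuousWithinAt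
  have hφ'0 : ∀ t ∈ Icc T U, -2 / t ^ 3 ≤ (0 : ℝ) := fun t ht ↦ by
    have := hT0.trans_le ht.1
    exact div_nonpos_of_nonpos_of_nonneg (by norm_num) (by positivity)
  have hφU : (0 : ℝ) ≤ 1 / U ^ 2 := by positivity
  have hL := lehman_sum_le hA hT hTU hφ hφ' hφ'0 hφU
  rw [integral_log_div_sq hT0 hTU, integral_inv_sq_div hT0 hTU] at hL
  -- drop the negative U-terms
  have hlogU : 0 ≤ (Real.log (U / (2 * π)) + 1) / U := by
    have : 0 ≤ Real.log (U / (2 * π)) := Real.log_nonneg (by rw [le_div_iff₀ h2π]; linarith)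
    positivity
  have hU2 : 0 ≤ 1 / (2 * U ^ 2) := by positivity
  have hlogT : 0 ≤ Real.log T := Real.log_nonneg (by linarith)
  have e1 : ((Real.log (T / (2 * π)) + 1) / T - (Real.log (U / (2 * π)) + 1) / U) / (2 * π) ≤
      (Real.log (T / (2 * π)) + 1) / (2 * π * T) := by
    rw [div_le_iff₀ h2π]
    have : (Real.log (T / (2 * π)) + 1) / (2 * π * T) * (2 * π) = (Real.log (T / (2 * π)) + 1) / T := by
      field_simp
    rw [this]
    linarith
  have e2 : A * (2 * (1 / T ^ 2) * Real.log T + (1 / (2 * T ^ 2) - 1 / (2 * U ^ 2))) ≤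
      A * (4 * Real.log T + 1) / (2 * T ^ 2) := by
    have : A * (4 * Real.log T + 1) / (2 * T ^ 2) = A * (2 * (1 / T ^ 2) * Real.log T + 1 / (2 * T ^ 2)) := by
      field_simp
      ring
    rw [this]
    gcongr
    linarith
  linarith

namespace BrentPlattTrudgian2022_cor1

/-- The two one-sided forms of Corollary 1: `N(t) ≤ L(t) + 0.28 log t`.
[cite: BrentPlattTrudgian2022, Cor. 1] -/
theorem count_le (h : BrentPlattTrudgian2022_cor1) {t : ℝ} (ht : 2 * π ≤ t) :
    (zetaZeroCount t : ℝ) ≤ countMain t + 0.28 * Real.log t := by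
  have := (abs_le.1 (h t ht)).2; linarith

/-- `L(t) − 0.28 log t ≤ N(t)`. [cite: BrentPlattTrudgian2022, Cor. 1] -/
theorem le_count (h : BrentPlattTrudgian2022_cor1) {t : ℝ} (ht : 2 * π ≤ t) :
    countMain t - 0.28 * Real.log t ≤ (zetaZeroCount t : ℝ) := by
  have := (abs_le.1 (h t ht)).1; linarith

set_option maxHeartbeats 400000 in -- unification of the decimal-constant instance of Lehman's lemma is slow
/-- **Lehman's lemma with `A = 0.28`** (Brent–Platt–Trudgian 2022, Lemma 2 with Cor. 1), `C¹`
non-increasing `φ ≥ 0`, `2π ≤ T₁ ≤ T₂`. [cite: BrentPlattTrudgian2022, Lemma 2 and Cor. 1] -/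
theorem lehman_abs (h : BrentPlattTrudgian2022_cor1) {T₁ T₂ : ℝ} (h1 : 2 * π ≤ T₁) (h12 : T₁ ≤ T₂)
    {φ φ' : ℝ → ℝ} (hφ : ∀ t ∈ Icc T₁ T₂, HasDerivAt φ (φ' t) t)
    (hφ' : ContinuousOn φ' (Icc T₁ T₂)) (hφ'0 : ∀ t ∈ Icc T₁ T₂, φ' t ≤ 0) (hφT : 0 ≤ φ T₂) :
    |∑ ρ ∈ zerosBetween T₁ T₂, (riemannZetaZeroOrder ρ : ℝ) * φ ρ.im
        - (∫ t in T₁..T₂, φ t * Real.log (t / (2 * π))) / (2 * π)| ≤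
      0.28 * (2 * φ T₁ * Real.log T₁ + ∫ t in T₁..T₂, φ t / t) :=
  by
  have hA : ∀ t : ℝ, 2 * π ≤ t → |(zetaZeroCount t : ℝ) - countMain t| ≤ 0.28 * Real.log t := h
  exact Literature.NumberTheory.LFunctions.abs_lehman hA h1 h12 hφ hφ' hφ'0 hφT

set_option maxHeartbeats 400000 in -- unification of the decimal-constant instance of Lehman's lemma is slow
/-- **Brent–Platt–Trudgian 2022, Lemma 5** (proved from Corollary 1): for `T ≥ 2πe` and every
`U ≥ T`, `Σ_{T<γ≤U} m(ρ)/γ² ≤ log T/(2πT)` — hence (suprema of non-negative partial sums) the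
printed `Σ_{γ>T} 1/γ² ≤ log T/(2πT)`. Numerics: `(1 − log 2π)/(2π T) + 0.28(4L+1)/(2T²) ≤ 0` for
`T ≥ 2πe`, using `log π > 1`, `log 2 > 0.6931`, `log x ≤ x − 1` and `2πe > 17.07`.
[cite: BrentPlattTrudgian2022, Lemma 5] -/
theorem sum_inv_sq_le (h : BrentPlattTrudgian2022_cor1) {T U : ℝ} (hT : 2 * π * Real.exp 1 ≤ T)
    (hTU : T ≤ U) :
    ∑ ρ ∈ zerosBetween T U, (riemannZetaZeroOrder ρ : ℝ) * (1 / ρ.im ^ 2) ≤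
      Real.log T / (2 * π * T) := by
  have hπ3 : 3.14159 < π := by linarith [Real.pi_gt_d6]
  have hπ4 : π < 3.1416 := by linarith [Real.pi_lt_d6]
  have he1 : 2.7182818283 < Real.exp 1 := Real.exp_one_gt_d9
  have he2 : Real.exp 1 < 2.7182818286 := Real.exp_one_lt_d9
  have hT0e : 17.07 < 2 * π * Real.exp 1 := by nlinarith
  have hT17 : 17.07 < T := by linarith
  have h2π : (0 : ℝ) < 2 * π := by positivity
  have hT2π : 2 * π ≤ T := by nlinarith
  have hT0 : 0 < T := by linarith
  have hA : ∀ t : ℝ, 2 * π ≤ t → |(zetaZeroCount t : ℝ) - countMain t| ≤ 0.28 * Real.log t := h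
  have h0 := sum_inv_sq_le_of_count hA hT2π hTU
  -- log(T/2π) = log T − log 2 − log π, with log π > 1 and log 2 > 0.6931
  have hlogsplit : Real.log (T / (2 * π)) = Real.log T - Real.log 2 - Real.log π := by
    rw [Real.log_div hT0.ne' h2π.ne', Real.log_mul (by norm_num) Real.pi_pos.ne']
    ring
  have hlogπ : 1 < Real.log π := by
    rw [← Real.exp_lt_exp, Real.exp_log Real.pi_pos]
    linarith
  have hlog2 : 0.6931471803 < Real.log 2 := Real.log_two_gt_d9
  -- log T ≤ log T₀ + (T − T₀)/T₀ with T₀ = 2πe, and log T₀ = 1 + log 2 + log π ≤ 2.849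
  set T₀ : ℝ := 2 * π * Real.exp 1 with hT₀
  have hT₀pos : 0 < T₀ := by positivity
  have hlogT₀ : Real.log T₀ = Real.log 2 + Real.log π + 1 := by
    rw [hT₀, Real.log_mul (by positivity) (Real.exp_pos 1).ne', Real.log_mul (by norm_num)
      Real.pi_pos.ne', Real.log_exp]
  have hlog2' : Real.log 2 < 0.6931471808 := Real.log_two_lt_d9
  have hlogπ' : Real.log π ≤ π / Real.exp 1 - 1 + 1 := by
    have := Real.log_le_sub_one_of_pos (div_pos Real.pi_pos (Real.exp_pos 1))
    rw [Real.log_div Real.pi_pos.ne' (Real.exp_pos 1).ne', Real.log_exp] at this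
    linarith
  have hπe : π / Real.exp 1 ≤ 1.1558 := by
    rw [div_le_iff₀ (Real.exp_pos 1)]; nlinarith
  have hlogT₀le : Real.log T₀ ≤ 2.849 := by linarith
  have hlogT : Real.log T ≤ Real.log T₀ + (T - T₀) / T₀ := by
    have := Real.log_le_sub_one_of_pos (div_pos hT0 hT₀pos)
    rw [Real.log_div hT0.ne' hT₀pos.ne'] at this
    have e : T / T₀ - 1 = (T - T₀) / T₀ := by field_simp
    linarith
  -- Goal: (log(T/2π)+1)/(2πT) + 0.28(4L+1)/(2T²) ≤ L/(2πT)
  -- i.e. 0.28 (4L+1)/(2T²) ≤ (log 2π − 1)/(2πT), i.e. 0.28 π (4L+1) ≤ (log 2 + log π − 1) T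
  have hkey : 0.28 * (4 * Real.log T + 1) / (2 * T ^ 2) ≤
      (Real.log 2 + Real.log π - 1) / (2 * π * T) := by
    rw [div_le_div_iff₀ (by positivity) (by positivity)]
    -- 0.28 (4L+1) (2πT) ≤ (log2 + logπ − 1)(2T²); divide by 2T: 0.28 π (4L+1) ≤ (log2+logπ−1) T
    have hLT : 4 * Real.log T + 1 ≤ 4 * (2.849 + (T - T₀) / T₀) + 1 := by linarith
    have hT₀17 : 17.07 < T₀ := hT0e
    have hTT₀ : T₀ ≤ T := hT
    -- (4L+1)/T ≤ (4·2.849 − 3)/T₀ + 4/T₀ ≤ 12.4/17.07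
    have hfrac : (4 * Real.log T + 1) ≤ T * (12.396 / 17.07) := by
      have h1 : 4 * (2.849 + (T - T₀) / T₀) + 1 = (4 * 2.849 - 3) + 4 * T / T₀ := by
        field_simp; ring
      rw [h1] at hLT
      have h2 : (4 * 2.849 - 3 : ℝ) ≤ T * ((4 * 2.849 - 3) / T₀) := by
        rw [mul_div_assoc', le_div_iff₀ hT₀pos]; nlinarith
      have h3 : 4 * T / T₀ ≤ T * (4 / 17.07) := by
        rw [div_le_iff₀ hT₀pos]; nlinarith
      have h4 : T * ((4 * 2.849 - 3) / T₀) ≤ T * ((4 * 2.849 - 3) / 17.07) := by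
        apply mul_le_mul_of_nonneg_left _ hT0.le
        apply div_le_div_of_nonneg_left (by norm_num) (by norm_num) hT₀17.le
      nlinarith
    have hc : 0.6931 < Real.log 2 + Real.log π - 1 := by linarith
    have s1 : 0.28 * (4 * Real.log T + 1) * (2 * π * T) ≤
        0.28 * (T * (12.396 / 17.07)) * (2 * π * T) := by
      have : 0 ≤ 2 * π * T := by positivity
      gcongr
    have s2 : 0.28 * (T * (12.396 / 17.07)) * (2 * π * T) ≤ 1.278 * T ^ 2 := by
      have hc2 : 0.28 * (12.396 / 17.07) * (2 * π) ≤ 1.278 := by nlinarith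
      have hTT : 0 ≤ T ^ 2 := sq_nonneg T
      nlinarith
    have s3 : 1.3862 * T ^ 2 ≤ (Real.log 2 + Real.log π - 1) * (2 * T ^ 2) := by
      have hTT : 0 ≤ T ^ 2 := sq_nonneg T
      nlinarith
    have hT2 : 0 < T ^ 2 := by positivity
    have s4 : 1.278 * T ^ 2 ≤ 1.3862 * T ^ 2 := mul_le_mul_of_nonneg_right (by norm_num) hT2.le
    linarith
  rw [hlogsplit] at h0
  have : (Real.log T - Real.log 2 - Real.log π + 1) / (2 * π * T) +
      (Real.log 2 + Real.log π - 1) / (2 * π * T) = Real.log T / (2 * π * T) := by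
    field_simp; ring
  linarith

end BrentPlattTrudgian2022_cor1

/-! ## Local zero counts and the harmonic sum over ordinates (proved consequences) -/

/-- Backlund's main term grows at most like its derivative at the right end-point:
for `0 < T` and `h ≥ 0`, `L(T+h) − L(T) ≤ h log((T+h)/2π)/(2π)` (mean value theorem; `L'`
is increasing). [cite: BrentPlattTrudgian2022, §2 (eq. for L(T))] -/
theorem countMain_sub_le {T h : ℝ} (hT : 0 < T) (hh : 0 ≤ h) :
    countMain (T + h) - countMain T ≤ h * Real.log ((T + h) / (2 * π)) / (2 * π) := by
  have h2π : (0 : ℝ) < 2 * π := by positivity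
  rcases hh.eq_or_lt with rfl | hpos
  · simp
  · have hab : T < T + h := by linarith
    obtain ⟨c, hc, hslope⟩ := exists_hasDerivAt_eq_slope countMain
      (fun t ↦ Real.log (t / (2 * π)) / (2 * π)) hab (continuousOn_countMain hT)
      (fun x hx ↦ hasDerivAt_countMain (hT.trans hx.1))
    have hc0 : 0 < c := hT.trans hc.1
    have hmono : Real.log (c / (2 * π)) ≤ Real.log ((T + h) / (2 * π)) :=
      Real.log_le_log (div_pos hc0 h2π) (by gcongr; exact hc.2.le)
    have e : countMain (T + h) - countMain T = h * (Real.log (c / (2 * π)) / (2 * π)) := by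
      have hne : h ≠ 0 := hpos.ne'
      rw [hslope, show T + h - T = h by ring]
      field_simp
    rw [e, mul_div_assoc]
    gcongr

/-- **Explicit local zero count** from `|N − L| ≤ A log t`: for `2π ≤ T` and `h ≥ 0`,
`N(T+h) − N(T) ≤ h log((T+h)/2π)/(2π) + A (log(T+h) + log T)` (the two-sided bound at `T` and
`T + h` plus `countMain_sub_le`). [cite: BrentPlattTrudgian2022, Lemma 1 and Cor. 1] -/
theorem zetaZeroCount_window_le_of_count {A T h : ℝ}
    (hA : ∀ t : ℝ, 2 * π ≤ t → |(zetaZeroCount t : ℝ) - countMain t| ≤ A * Real.log t)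
    (hT : 2 * π ≤ T) (hh : 0 ≤ h) :
    (zetaZeroCount (T + h) : ℝ) - zetaZeroCount T ≤
      h * Real.log ((T + h) / (2 * π)) / (2 * π) + A * (Real.log (T + h) + Real.log T) := by
  have hπ : 3 < π := Real.pi_gt_three
  have h1 := (abs_le.1 (hA (T + h) (by linarith))).2
  have h2 := (abs_le.1 (hA T hT)).1
  have h3 := countMain_sub_le (by linarith : 0 < T) hh
  linarith

/-- `∫_{T₁}^{T} (1/t) log(t/2π) dt = (log²(T/2π) − log²(T₁/2π))/2` for `0 < T₁ ≤ T`.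
[cite: BrentPlattTrudgian2022, Lemma 8 (proof, first display)] -/
theorem integral_inv_mul_log {T₁ T : ℝ} (h0 : 0 < T₁) (h1T : T₁ ≤ T) :
    ∫ t in T₁..T, 1 / t * Real.log (t / (2 * π)) =
      (Real.log (T / (2 * π)) ^ 2 - Real.log (T₁ / (2 * π)) ^ 2) / 2 := by
  have h2π : (0 : ℝ) < 2 * π := by positivity
  have hIcc : uIcc T₁ T = Icc T₁ T := uIcc_of_le h1T
  have hF : ∀ t ∈ uIcc T₁ T, HasDerivAt (fun s : ℝ ↦ Real.log (s / (2 * π)) ^ 2 / 2)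
      (1 / t * Real.log (t / (2 * π))) t := by
    intro t ht
    rw [hIcc] at ht
    have ht0 : 0 < t := h0.trans_le ht.1
    have hl : HasDerivAt (fun s : ℝ ↦ s / (2 * π)) (1 / (2 * π)) t := by
      simpa using (hasDerivAt_id t).div_const (2 * π)
    have hlog : HasDerivAt (fun s : ℝ ↦ Real.log (s / (2 * π))) (1 / t) t := by
      have h2 := (Real.hasDerivAt_log (div_pos ht0 h2π).ne').comp t hl
      have e : (t / (2 * π))⁻¹ * (1 / (2 * π)) = 1 / t := by field_simp
      rw [e] at h2
      exact h2
    have h := (hlog.pow 2).div_const 2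
    refine h.congr_deriv ?_
    simp only [Nat.cast_ofNat]
    ring
  have hint : IntervalIntegrable (fun t : ℝ ↦ 1 / t * Real.log (t / (2 * π))) volume T₁ T := by
    refine ContinuousOn.intervalIntegrable_of_Icc h1T fun t ht ↦ ?_
    have ht0 : 0 < t := h0.trans_le ht.1
    have hne : id t ≠ 0 := by simpa using ht0.ne'
    exact ((continuousAt_const.div continuousAt_id hne).mul
      ((Real.continuousAt_log (by positivity)).comp (continuousAt_id.div_const _))).continuousWithinAt
  rw [integral_eq_sub_of_hasDerivAt hF hint]
  ring

/-- `∫_{T₁}^{T} (1/t)/t dt = 1/T₁ − 1/T` for `0 < T₁ ≤ T`. [cite: BrentPlattTrudgian2022, Lemma 8 (proof, first display)] -/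
theorem integral_inv_div {T₁ T : ℝ} (h0 : 0 < T₁) (h1T : T₁ ≤ T) :
    ∫ t in T₁..T, 1 / t / t = 1 / T₁ - 1 / T := by
  have hIcc : uIcc T₁ T = Icc T₁ T := uIcc_of_le h1T
  have hF : ∀ t ∈ uIcc T₁ T, HasDerivAt (fun s : ℝ ↦ -s⁻¹) (1 / t / t) t := by
    intro t ht
    rw [hIcc] at ht
    have ht0 : 0 < t := h0.trans_le ht.1
    have h := (hasDerivAt_inv ht0.ne').neg
    refine h.congr_deriv ?_
    field_simp
  have hint : IntervalIntegrable (fun t : ℝ ↦ 1 / t / t) volume T₁ T := by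
    refine ContinuousOn.intervalIntegrable_of_Icc h1T fun t ht ↦ ?_
    have ht0 : 0 < t := h0.trans_le ht.1
    have hne : id t ≠ 0 := by simpa using ht0.ne'
    exact ((continuousAt_const.div continuousAt_id hne).div continuousAt_id hne).continuousWithinAt
  rw [integral_eq_sub_of_hasDerivAt hF hint]
  simp only [one_div]
  ring

/-- **The harmonic sum over ordinates between two heights** (the first display in the proof of
Brent–Platt–Trudgian 2022, Lemma 8, via Lehman's lemma with `φ(t) = 1/t`): if
`|N(t) − L(t)| ≤ A log t` for `t ≥ 2π`, then for `2π ≤ T₁ ≤ T`,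
`|Σ_{T₁<γ≤T} m(ρ)/γ − (log²(T/2π) − log²(T₁/2π))/(4π)| ≤ A (2 log T₁ + 1)/T₁`.
[cite: BrentPlattTrudgian2022, Lemma 8 (proof)] -/
theorem abs_sum_inv_sub_le_of_count {A T₁ T : ℝ}
    (hA : ∀ t : ℝ, 2 * π ≤ t → |(zetaZeroCount t : ℝ) - countMain t| ≤ A * Real.log t)
    (h1 : 2 * π ≤ T₁) (h1T : T₁ ≤ T) :
    |∑ ρ ∈ zerosBetween T₁ T, (riemannZetaZeroOrder ρ : ℝ) * (1 / ρ.im)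
        - (Real.log (T / (2 * π)) ^ 2 - Real.log (T₁ / (2 * π)) ^ 2) / (4 * π)| ≤
      A * (2 * Real.log T₁ + 1) / T₁ := by
  have hπ : 3 < π := Real.pi_gt_three
  have h0 : 0 < T₁ := by linarith
  have hT0 : 0 < T := by linarith
  have hA0 : 0 ≤ A := by
    have h1' := hA T₁ h1
    have hlogT : 0 < Real.log T₁ := Real.log_pos (by linarith)
    have : 0 ≤ A * Real.log T₁ := (abs_nonneg _).trans h1'
    nlinarith
  have hφ : ∀ t ∈ Icc T₁ T, HasDerivAt (fun s : ℝ ↦ 1 / s) (-1 / t ^ 2) t := by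
    intro t ht
    have ht0 : 0 < t := h0.trans_le ht.1
    have h := hasDerivAt_inv ht0.ne'
    have h' := h.congr_of_eventuallyEq (f₁ := fun s : ℝ ↦ 1 / s)
      (Filter.Eventually.of_forall fun s ↦ by simp only [one_div])
    refine h'.congr_deriv ?_
    field_simp
  have hφ' : ContinuousOn (fun t : ℝ ↦ -1 / t ^ 2) (Icc T₁ T) := fun t ht ↦ by
    have ht0 : 0 < t := h0.trans_le ht.1
    have hne : (fun x : ℝ ↦ x ^ 2) t ≠ 0 := by simp only [ne_eq]; positivity
    exact (continuousAt_const.div (continuousAt_id.pow 2) hne).continuousWithinAt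
  have hφ'0 : ∀ t ∈ Icc T₁ T, -1 / t ^ 2 ≤ (0 : ℝ) := fun t ht ↦ by
    have := h0.trans_le ht.1
    exact div_nonpos_of_nonpos_of_nonneg (by norm_num) (by positivity)
  have hφT : (0 : ℝ) ≤ 1 / T := by positivity
  have hL := abs_lehman hA h1 h1T hφ hφ' hφ'0 hφT
  rw [integral_inv_mul_log h0 h1T, integral_inv_div h0 h1T] at hL
  have e1 : (Real.log (T / (2 * π)) ^ 2 - Real.log (T₁ / (2 * π)) ^ 2) / 2 / (2 * π) =
      (Real.log (T / (2 * π)) ^ 2 - Real.log (T₁ / (2 * π)) ^ 2) / (4 * π) := by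
    field_simp; ring
  rw [e1] at hL
  have e2 : A * (2 * (1 / T₁) * Real.log T₁ + (1 / T₁ - 1 / T)) ≤ A * (2 * Real.log T₁ + 1) / T₁ := by
    have : A * (2 * Real.log T₁ + 1) / T₁ = A * (2 * (1 / T₁) * Real.log T₁ + 1 / T₁) := by
      field_simp
    rw [this]
    have hT' : 0 ≤ 1 / T := by positivity
    gcongr
    linarith
  exact hL.trans e2

namespace BrentPlattTrudgian2022_cor1

set_option maxHeartbeats 400000 in -- unification of the decimal-constant instance is slow
/-- **Explicit local zero count** (from Corollary 1): for `2π ≤ T`, `h ≥ 0`,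
`N(T+h) − N(T) ≤ h log((T+h)/2π)/(2π) + 0.28 (log(T+h) + log T)`; e.g. `h = 1`:
`N(T+1) − N(T) ≤ log((T+1)/2π)/(2π) + 0.56 log(T+1)`.
[cite: BrentPlattTrudgian2022, Cor. 1] -/
theorem window_le (h : BrentPlattTrudgian2022_cor1) {T w : ℝ} (hT : 2 * π ≤ T) (hw : 0 ≤ w) :
    (zetaZeroCount (T + w) : ℝ) - zetaZeroCount T ≤
      w * Real.log ((T + w) / (2 * π)) / (2 * π) + 0.28 * (Real.log (T + w) + Real.log T) := by
  have hA : ∀ t : ℝ, 2 * π ≤ t → |(zetaZeroCount t : ℝ) - countMain t| ≤ 0.28 * Real.log t := h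
  exact zetaZeroCount_window_le_of_count hA hT hw

set_option maxHeartbeats 400000 in -- unification of the decimal-constant instance is slow
/-- **The harmonic sum between two heights** (from Corollary 1; the first display in the proof of
Lemma 8 with `A = 0.28`): for `2π ≤ T₁ ≤ T`,
`|Σ_{T₁<γ≤T} m(ρ)/γ − (log²(T/2π) − log²(T₁/2π))/(4π)| ≤ 0.28 (2 log T₁ + 1)/T₁`.
[cite: BrentPlattTrudgian2022, Lemma 8 (proof) and Cor. 1] -/
theorem abs_sum_inv_sub_le (h : BrentPlattTrudgian2022_cor1) {T₁ T : ℝ} (h1 : 2 * π ≤ T₁)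
    (h1T : T₁ ≤ T) :
    |∑ ρ ∈ zerosBetween T₁ T, (riemannZetaZeroOrder ρ : ℝ) * (1 / ρ.im)
        - (Real.log (T / (2 * π)) ^ 2 - Real.log (T₁ / (2 * π)) ^ 2) / (4 * π)| ≤
      0.28 * (2 * Real.log T₁ + 1) / T₁ := by
  have hA : ∀ t : ℝ, 2 * π ≤ t → |(zetaZeroCount t : ℝ) - countMain t| ≤ 0.28 * Real.log t := h
  exact abs_sum_inv_sub_le_of_count hA h1 h1T

set_option maxHeartbeats 400000 in -- unification of the decimal-constant instance is slow
/-- **A clean explicit zero count** (from Corollary 1): `N(T) ≤ T log T/(2π)` for every `T ≥ 2π`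
(since `L(T) + 0.28 log T = T log T/(2π) − T(log 2π + 1)/(2π) + 7/8 + 0.28 log T` and
`7/8 + 0.28 log T ≤ T(log 2π + 1)/(2π)` there, using `log T ≤ log 2π + T/(2π) − 1`).
[cite: BrentPlattTrudgian2022, Cor. 1] -/
theorem count_le_simple (h : BrentPlattTrudgian2022_cor1) {T : ℝ} (hT : 2 * π ≤ T) :
    (zetaZeroCount T : ℝ) ≤ T * Real.log T / (2 * π) := by
  have hπ3 : 3 < π := Real.pi_gt_three
  have hπ4 : π < 3.1416 := by linarith [Real.pi_lt_d6]
  have h2π : (0 : ℝ) < 2 * π := by positivity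
  have hT0 : 0 < T := by linarith
  have h1 := count_le h hT
  have hlog2π1 : 1 < Real.log (2 * π) := by
    rw [← Real.exp_lt_exp, Real.exp_log h2π]
    have := Real.exp_one_lt_d9
    linarith
  have hlog2π2 : Real.log (2 * π) ≤ 2 * π - 1 := by linarith [Real.log_le_sub_one_of_pos h2π]
  -- log T ≤ log 2π + T/(2π) − 1
  have hlogT : Real.log T ≤ Real.log (2 * π) + (T / (2 * π) - 1) := by
    have := Real.log_le_sub_one_of_pos (div_pos hT0 h2π)
    rw [Real.log_div hT0.ne' h2π.ne'] at this
    linarith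
  have hlogT0 : 0 ≤ Real.log T := Real.log_nonneg (by linarith)
  -- unfold L(T)
  have e : countMain T = T * Real.log T / (2 * π) - T * (Real.log (2 * π) + 1) / (2 * π) + 7 / 8 := by
    unfold countMain
    rw [Real.log_div hT0.ne' h2π.ne']
    field_simp
    ring
  rw [e] at h1
  -- need: 7/8 + 0.28 log T ≤ T (log 2π + 1)/(2π)
  have hkey : 7 / 8 + 0.28 * Real.log T ≤ T * (Real.log (2 * π) + 1) / (2 * π) := by
    set u : ℝ := T / (2 * π) with hu_def
    have hu : 1 ≤ u := by rw [hu_def, le_div_iff₀ h2π]; linarith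
    have e1 : T * (Real.log (2 * π) + 1) / (2 * π) = u * (Real.log (2 * π) + 1) := by
      rw [hu_def]; field_simp
    rw [e1]
    have hl0 : 0 ≤ Real.log (2 * π) := by linarith
    nlinarith [mul_nonneg (sub_nonneg.2 hu) hl0]
  linarith

end BrentPlattTrudgian2022_cor1

/-! ## Explicit `S(T)` from the two `N(T)` facts (proved consequences) -/

/-- **Explicit `|S(T)|` à la Platt–Trudgian 2015** from the two named facts: for `T ≥ 2πe`,
`|S(T)| ≤ 0.11 log T + 0.29 log log T + 2.29 + 0.2/T + 1/(150T)`
(`|S| ≤ |N − L| + |(N − L) − S|`: Brent–Platt–Trudgian 2022 Lemma 1 and 2021 Lemma 2), with the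
tree's right-continuous `S = zetaArgS`.
[cite: BrentPlattTrudgian2022, Lemma 1] [cite: BrentPlattTrudgian2021, Lemma 2] -/
theorem BrentPlattTrudgian2022_lemma1.abs_zetaArgS_le (h₁ : BrentPlattTrudgian2022_lemma1)
    (h₂ : BrentPlattTrudgian2021_lemma2) {T : ℝ} (hT : 2 * π * Real.exp 1 ≤ T) :
    |zetaArgS T| ≤
      0.11 * Real.log T + 0.29 * Real.log (Real.log T) + 2.29 + 0.2 / T + 1 / (150 * T) := by
  have hπ : 3 < π := Real.pi_gt_three
  have he : 1 ≤ Real.exp 1 := by have := Real.add_one_le_exp (1 : ℝ); linarith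
  have h2π : 2 * π ≤ T := by nlinarith
  have a := h₁ T hT
  have b := h₂ T h2π
  have e : zetaArgS T = ((zetaZeroCount T : ℝ) - countMain T)
      - (((zetaZeroCount T : ℝ) - countMain T) - zetaArgS T) := by ring
  rw [e]
  exact (abs_sub _ _).trans (by linarith)

/-- **Explicit `|S(T)| ≤ 0.28 log T + 1/(150T)`** for `T ≥ 2π`, from Corollary 1 and Lemma 2 of
the Math. Comp. paper. [cite: BrentPlattTrudgian2022, Cor. 1] [cite: BrentPlattTrudgian2021, Lemma 2] -/
theorem BrentPlattTrudgian2022_cor1.abs_zetaArgS_le (h₁ : BrentPlattTrudgian2022_cor1)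
    (h₂ : BrentPlattTrudgian2021_lemma2) {T : ℝ} (hT : 2 * π ≤ T) :
    |zetaArgS T| ≤ 0.28 * Real.log T + 1 / (150 * T) := by
  have a := h₁ T hT
  have b := h₂ T hT
  have e : zetaArgS T = ((zetaZeroCount T : ℝ) - countMain T)
      - (((zetaZeroCount T : ℝ) - countMain T) - zetaArgS T) := by ring
  rw [e]
  exact (abs_sub _ _).trans (by linarith)

end Literature.NumberTheory.LFunctions

end
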